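import Summits.HodgeConjecture.HodgeConjecture.Theorems.Ring2WeilCoverageNormClassEq
import Summits.HodgeConjecture.HodgeConjecture.Theorems.Ring2WeilCoverageNormTableB
import Summits.HodgeConjecture.HodgeConjecture.Theorems.Ring2WeilCoverageNormTableC
import HarnessLib

/-!
# Weil-type family coverage — product windows, part V: the FIRST curve-carried member on a non-split `ℚ(√-11)` row other than R4 — `W6.11.14 = (3, ℚ(√-11), [14])` — from the NEW carrier `PSL₂(11)` (`λ` of degree 5); the rows `W6.7.65`, `W6.7.85` (`PSL₂(7) × S₆₅ / A₈₅`, constructive), and a ×2 of ring2-b06's `W6.7.15` (`PSL₂(7) × A₇`-on-15)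

research route conditional on HC_CM; not a corollary; Q11.4-sentence-2 already refuted in dim ≥ 3.

Ring 2, WEIL-TYPE FAMILY-COVERAGE CENSUS (`HOME/WEIL-FAMILY-COVERAGE.md` `## b04`, block b04.15 P.S. 7, owner ring2-b04, gen 51); twenty-second part of
`Ring2WeilCoverageProductWindow` (same conventions as parts L–U).  The carrier `L211`: `G₁ = PSL₂(11)` acting on `ℙ¹(𝔽₁₁)`, `λ` one of the two
irreducible characters of degree 5 (values `5, 1, -1, 0, 0, 1, (-1+√-11)/2, (-1-√-11)/2` on `1A 2A 3A 5A 5B 6A 11A 11B`; character field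
`K = ℚ(√-11)`), `H₁ = D₁₂` (`⟨λ|_{D₁₂}, 1⟩ = 1`, index 55), `K`-structure from the class sum of `11A`.  A Chevalley–Weil census of the `(3,3)`
data with `r₁` odd (three or four branch values, base of genus ≤ 2) for `n ≤ 44` finds the degrees `6, 8, 9, 10, 12, 14, 15, 16, 18, 24` only;
`n = 14` is the one census row among their classes.  NOTE `S_in(PSL₂(11), λ) = {2}` (`2` is inert in `K`, `4 ∣ 660`, `4 ∤ 5`), so THEOREM
S7's hypothesis fails at `2` and the law `[n]^{r₁}` is NOT guaranteed by S7/S8 here — the engine's exact `det H` decides, and on both data the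
class IS `[14]` (`T = {2,7}`): §1 `PSL₂(11) × A₁₄` `(11a:11.3, 2:2⁶.1², 3:3⁴.1²)` (`Y` genus 31, 770 sheets, Galois closure of genus
1 961 511 552 001): `det H = -640/2541`; `PSL₂(11) × S₁₄` `(11a:11.3, 2:2⁵.1⁴, 3:3⁴.2)` (`Y` genus 37): `det H = -461600/6792093`; both `(3,3)` WEIL
TYPE with `ℚ(√-11)`-multiplication (random realisation, Jordan certificates; engine `bigwin.py` + `fastcover.py`, 217 s + 223 s, this seat).
§2 `W6.7.65 = (3, ℚ(√-7), [65])` (`T = {5,13}`) and §3 `W6.7.85 = (3, ℚ(√-7), [85])` (`T = {5,17}`) by CONSTRUCTIVE realisation (as in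
part U: `planmap.py` + `fastcover.py`): `PSL₂(7) × S₆₅` `(2:2³².1, 3:3²⁰.2.1³, 7a:7⁹.2)` (`Y` genus 55, 3 640 sheets, kit j209961) `det H = -1/58240`,
`(2:2³¹.1³, 3:3²¹.1², 7a:7⁹.2)` (`Y` genus 47) `-19889/713440`; `PSL₂(7) × A₈₅` `(2:2⁴².1, 3:3²⁷.1⁴, 7a:7¹².1)` — the UNIQUE `(3,3)` cycle-type
datum of the `(2A, 3A, 7A)` window at `n = 85` (`Y` genus 55, 4 760 sheets, Galois closure of genus ≈ 2.8·10¹²⁸, kit j209962, 576 s) —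
`det H = -15667/1865920`.  With these the `(2A, 3A, 7A)` window of `PSL₂(7)` is EXHAUSTED on the census rows: its Chevalley–Weil bound is
`n ≤ 98 - 7b₂ - 6b₇` (`b₂`, `b₇` = fixed points of the `S_n`-components of the involution and of the 7-element; extra branch values cost 42
each), so `W6.7.221` is out of its reach.
§4 ×2 of ring2-b06's `W6.7.15 = (3, ℚ(√-7), [15])` datum (their `A7on15` window, b06 g99) on this seat's engine: `PSL₂(7) × A₇` with `A₇`
acting 2-transitively on the 15 cosets of a subgroup `PSL₂(7)` (`A₇ < A₈ ≅ GL₄(2)` on `ℙ³(𝔽₂)`), classes `(2:2⁶.1³, 4:4³.2.1, 7a:7².1)` (note the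
`G₁`-triple `(2, 4, 7a)`), genus 22 681, `Y` genus 46, 840 sheets: `(3,3)`, `det H = -14023/2634240`, `T = {3,5}`, class `[15]` ✓ (S7: `[15]^{r₁}`,
`r₁ = 1`).

No `def`, no named fact, no `sorry`; nothing here is a statement about Hodge classes; `HC_CM` is used nowhere.
References: [cite: vanGeemen1994HodgeAV, (5.4.1), Lemma 5.2]; [cite: Serre1973, Ch. III §1].
-/

set_option linter.dupNamespace false

open Literature.AlgebraicGeometry.Motives
open Literature.AlgebraicGeometry.VanGeemen1994
open Summit.HodgeConjecture.HodgeConjecture.Ring2.Hypotheses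

namespace Summit.HodgeConjecture.HodgeConjecture.Ring2.WeilCoverage

/-! ### §1 `W6.11.14 = (3, ℚ(√-11), [14])`: `PSL₂(11) × A₁₄ / S₁₄` -/

/-- FIBRE-PRODUCT datum `L211xA14` `(0; 11a:11.3,2:2^6.1^2,3:3^4.1^2)` (cycle types in `A14`; Hurwitz dimension 0; realised by explicit permutations with product one, generation: 2-transitive + Jordan (a 3-cycle as the 11-th power of a branch cycle, 3 <= n-3) => monodromy >= A_14): `Y = D ×_{ℙ¹} X` (genus 31; `D` the `L211`-quotient datum = the `H₁`-quotient of the `L211`-curve `C̃/A14`, `X` the degree-14 cover, genus 0), computed on its 770 sheets (engine `bigwin.py` with the sparse cohomology `fastcover.py`, exact); the HIDDEN FACTOR `B` = the `λ`-part of the Prym `P(Y/D)` — an abelian SIXFOLD with `(3,3)` `ℚ(√-11)`-action, WEIL TYPE — has literal `det H|_B = -640/2541`, `a = 640/2541`, `T(a) = [2, 7]`: row `W6.11.14` (NON-split); `r₁ = dim_K H¹(D)_λ = 1`, `r_H = 7`. THEOREM S8 (Prym form of the product-window law, census b04.15 (A): `[a_B] = [n]^{r₁}`, no 2-transitivity needed)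 predicts `T(a_B) = [2, 7]` from `r₁ = 1`, `n = 14` — CONFIRMED.
research route conditional on HC_CM; not a corollary; Q11.4-sentence-2 already refuted in dim ≥ 3. [cite: vanGeemen1994HodgeAV, (5.4.1)] -/
theorem fibre11_L211A14_n14_d7b2dd_mk_detH_ne_split :
    (QuotientGroup.mk (Units.mk0 (((-640 : ℚ) / 2541)) (by norm_num)) : weilNormResidueGroup 11) ≠
      splitDiscriminantClass 3 11 := by
  have e : Units.mk0 (((-640 : ℚ) / 2541)) (by norm_num) = -(Units.mk0 ((640 : ℚ) / 2541) (by norm_num)) := Units.ext (by norm_num)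
  rw [Ne, e, mk_neg_eq_splitDiscriminantClass_iff_of_odd (n := 3) (by decide)]
  have h := mul_not_mem_normUnitsSubgroup (mem_normUnitsSubgroup_of_sq_add_mul_sq (d := 11) (a := ((320 : ℚ) / 17787)) (by norm_num) ((-16 : ℚ) / 231) ((8 : ℚ) / 231) (by norm_num))
    Summit.HodgeConjecture.HodgeConjecture.Ring2.WeilCoverage.SqrtNeg11.not_mem_14
  rw [mk0_mul_mk0] at h
  norm_num at h
  exact h

/-- The same datum, CELL IDENTIFICATION: `[det H|_B] = [-14]` in `ℚˣ/Nm(ℚ(√-11)ˣ)` — the census ROW KEY of `W6.11.14` (`a·14 = ((1280 : ℚ) / 363) = (((-32 : ℚ) / 33))² + 11·(((16 : ℚ) / 33))²`).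
research route conditional on HC_CM; not a corollary; Q11.4-sentence-2 already refuted in dim ≥ 3. [cite: vanGeemen1994HodgeAV, Lemma 5.2 (3)] -/
theorem fibre11_L211A14_n14_d7b2dd_mk_detH_eq_key :
    (QuotientGroup.mk (Units.mk0 (-(((640 : ℚ) / 2541))) (neg_ne_zero.2 (by norm_num))) : weilNormResidueGroup 11) =
      QuotientGroup.mk (Units.mk0 (-(14 : ℚ)) (neg_ne_zero.2 (by norm_num))) :=
  mk_neg_eq_mk_neg_of_mul_mem (by norm_num) (by norm_num)
    (mem_normUnitsSubgroup_of_sq_add_mul_sq _ ((-32 : ℚ) / 33) ((16 : ℚ) / 33) (by norm_num))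

/-- FIBRE-PRODUCT datum `L211xS14` `(0; 11a:11.3,2:2^5.1^4,3:3^4.2)` (cycle types in `S14`; Hurwitz dimension 0; realised by explicit permutations with product one, generation: 2-transitive + Jordan (a 2-cycle as the 3-th power of a branch cycle, 2 <= n-3) => monodromy >= A_14): `Y = D ×_{ℙ¹} X` (genus 37; `D` the `L211`-quotient datum = the `H₁`-quotient of the `L211`-curve `C̃/S14`, `X` the degree-14 cover, genus 0), computed on its 770 sheets (engine `bigwin.py` with the sparse cohomology `fastcover.py`, exact); the HIDDEN FACTOR `B` = the `λ`-part of the Prym `P(Y/D)` — an abelian SIXFOLD with `(3,3)` `ℚ(√-11)`-action, WEIL TYPE — has literal `det H|_B = -461600/6792093`, `a = 461600/6792093`, `T(a) = [2, 7]`: row `W6.11.14` (NON-split); `r₁ = dim_K H¹(D)_λ = 1`, `r_H = 7`. THEOREM S8 (Prym form of the product-window law, census b04.15 (A): `[a_B] = [n]^{r₁}`, no 2-transitivity needed) predicts `T(a_B) = [2, 7]` from `r₁ = 1`, `n = 14` — CONFIRMED.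
research route conditional on HC_CM; not a corollary; Q11.4-sentence-2 already refuted in dim ≥ 3. [cite: vanGeemen1994HodgeAV, (5.4.1)] -/
theorem fibre11_L211S14_n14_96965b_mk_detH_ne_split :
    (QuotientGroup.mk (Units.mk0 (((-461600 : ℚ) / 6792093)) (by norm_num)) : weilNormResidueGroup 11) ≠
      splitDiscriminantClass 3 11 := by
  have e : Units.mk0 (((-461600 : ℚ) / 6792093)) (by norm_num) = -(Units.mk0 ((461600 : ℚ) / 6792093) (by norm_num)) := Units.ext (by norm_num)
  rw [Ne, e, mk_neg_eq_splitDiscriminantClass_iff_of_odd (n := 3) (by decide)]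
  have h := mul_not_mem_normUnitsSubgroup (mem_normUnitsSubgroup_of_sq_add_mul_sq (d := 11) (a := ((230800 : ℚ) / 47544651)) (by norm_num) ((-10 : ℚ) / 693) ((470 : ℚ) / 22869) (by norm_num))
    Summit.HodgeConjecture.HodgeConjecture.Ring2.WeilCoverage.SqrtNeg11.not_mem_14
  rw [mk0_mul_mk0] at h
  norm_num at h
  exact h

/-- The same datum, CELL IDENTIFICATION: `[det H|_B] = [-14]` in `ℚˣ/Nm(ℚ(√-11)ˣ)` — the census ROW KEY of `W6.11.14` (`a·14 = ((923200 : ℚ) / 970299) = (((-20 : ℚ) / 99))² + 11·(((940 : ℚ) / 3267))²`).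
research route conditional on HC_CM; not a corollary; Q11.4-sentence-2 already refuted in dim ≥ 3. [cite: vanGeemen1994HodgeAV, Lemma 5.2 (3)] -/
theorem fibre11_L211S14_n14_96965b_mk_detH_eq_key :
    (QuotientGroup.mk (Units.mk0 (-(((461600 : ℚ) / 6792093))) (neg_ne_zero.2 (by norm_num))) : weilNormResidueGroup 11) =
      QuotientGroup.mk (Units.mk0 (-(14 : ℚ)) (neg_ne_zero.2 (by norm_num))) :=
  mk_neg_eq_mk_neg_of_mul_mem (by norm_num) (by norm_num)
    (mem_normUnitsSubgroup_of_sq_add_mul_sq _ ((-20 : ℚ) / 99) ((940 : ℚ) / 3267) (by norm_num))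

/-! ### §2–§3 `W6.7.65` and `W6.7.85`: `PSL₂(7) × S₆₅ / A₈₅`, constructive realisation -/

/-- FIBRE-PRODUCT datum `L27cxS65` `(0; 2:2^32.1,3:3^20.2.1^3,7a:7^9.2)` (cycle types in `S65`; Hurwitz dimension 0; CONSTRUCTED by depth-first search on planar hypermaps of the prescribed type (`planmap.py`; the random search fails on near-regular cycle types), then certified: generation: 2-transitive + Jordan (a 2-cycle as the 3-th power of a branch cycle, 2 <= n-3) => monodromy >= A_65): `Y = D ×_{ℙ¹} X` (genus 55; `D` the `L27c`-quotient datum = the `H₁`-quotient of the `L27c`-curve `C̃/S65`, `X` the degree-65 cover, genus 0), computed on its 3640 sheets (engine `bigwin.py` with the sparse cohomology `fastcover.py`, exact); the HIDDEN FACTOR `B` = the `λ`-part of the Prym `P(Y/D)` — an abelian SIXFOLD with `(3,3)` `ℚ(√-7)`-action, WEIL TYPE — has literal `det H|_B = -1/58240`, `a = 1/58240`, `T(a) = [5, 13]`: row `W6.7.65` (NON-split); `r₁ = dim_K H¹(D)_λ = 1`, `r_H = 7`. THEOREM S8 (Prym form of the product-window law, census b04.15 (A): `[a_B] = [n]^{r₁}`,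 no 2-transitivity needed) predicts `T(a_B) = [5, 13]` from `r₁ = 1`, `n = 65` — CONFIRMED.
research route conditional on HC_CM; not a corollary; Q11.4-sentence-2 already refuted in dim ≥ 3. [cite: vanGeemen1994HodgeAV, (5.4.1)] -/
theorem fibre7_L27cS65_n65_40fcce_mk_detH_ne_split :
    (QuotientGroup.mk (Units.mk0 (((-1 : ℚ) / 58240)) (by norm_num)) : weilNormResidueGroup 7) ≠
      splitDiscriminantClass 3 7 := by
  have e : Units.mk0 (((-1 : ℚ) / 58240)) (by norm_num) = -(Units.mk0 ((1 : ℚ) / 58240) (by norm_num)) := Units.ext (by norm_num)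
  rw [Ne, e, mk_neg_eq_splitDiscriminantClass_iff_of_odd (n := 3) (by decide)]
  have h := mul_not_mem_normUnitsSubgroup (mem_normUnitsSubgroup_of_sq_add_mul_sq (d := 7) (a := ((1 : ℚ) / 3785600)) (by norm_num) ((-1 : ℚ) / 2080) ((1 : ℚ) / 14560) (by norm_num))
    Summit.HodgeConjecture.HodgeConjecture.Ring2.WeilCoverage.SqrtNeg7.not_mem_65
  rw [mk0_mul_mk0] at h
  norm_num at h
  exact h

/-- The same datum, CELL IDENTIFICATION: `[det H|_B] = [-65]` in `ℚˣ/Nm(ℚ(√-7)ˣ)` — the census ROW KEY of `W6.7.65` (`a·65 = ((1 : ℚ) / 896) = (((-1 : ℚ) / 32))² + 7·(((1 : ℚ) / 224))²`).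
research route conditional on HC_CM; not a corollary; Q11.4-sentence-2 already refuted in dim ≥ 3. [cite: vanGeemen1994HodgeAV, Lemma 5.2 (3)] -/
theorem fibre7_L27cS65_n65_40fcce_mk_detH_eq_key :
    (QuotientGroup.mk (Units.mk0 (-(((1 : ℚ) / 58240))) (neg_ne_zero.2 (by norm_num))) : weilNormResidueGroup 7) =
      QuotientGroup.mk (Units.mk0 (-(65 : ℚ)) (neg_ne_zero.2 (by norm_num))) :=
  mk_neg_eq_mk_neg_of_mul_mem (by norm_num) (by norm_num)
    (mem_normUnitsSubgroup_of_sq_add_mul_sq _ ((-1 : ℚ) / 32) ((1 : ℚ) / 224) (by norm_num))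

/-- FIBRE-PRODUCT datum `L27cxS65` `(0; 2:2^31.1^3,3:3^21.1^2,7a:7^9.2)` (cycle types in `S65`; Hurwitz dimension 0; CONSTRUCTED by depth-first search on planar hypermaps of the prescribed type (`planmap.py`; the random search fails on near-regular cycle types), then certified: generation: 2-transitive + Jordan (a 2-cycle as the 7-th power of a branch cycle, 2 <= n-3) => monodromy >= A_65): `Y = D ×_{ℙ¹} X` (genus 47; `D` the `L27c`-quotient datum = the `H₁`-quotient of the `L27c`-curve `C̃/S65`, `X` the degree-65 cover, genus 0), computed on its 3640 sheets (engine `bigwin.py` with the sparse cohomology `fastcover.py`, exact); the HIDDEN FACTOR `B` = the `λ`-part of the Prym `P(Y/D)` — an abelian SIXFOLD with `(3,3)` `ℚ(√-7)`-action, WEIL TYPE — has literal `det H|_B = -19889/713440`, `a = 19889/713440`, `T(a) = [5, 13]`: row `W6.7.65` (NON-split); `r₁ = dim_K H¹(D)_λ = 1`, `r_H = 7`. THEOREM S8 (Prym form of the product-window law, census b04.15 (A): `[a_B] = [n]^{r₁}`, no 2-transitivity needed) predicts `T(a_B) = [5, 13]` from `r₁ = 1`, `n = 65` — CONFIRMED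.
research route conditional on HC_CM; not a corollary; Q11.4-sentence-2 already refuted in dim ≥ 3. [cite: vanGeemen1994HodgeAV, (5.4.1)] -/
theorem fibre7_L27cS65_n65_072418_mk_detH_ne_split :
    (QuotientGroup.mk (Units.mk0 (((-19889 : ℚ) / 713440)) (by norm_num)) : weilNormResidueGroup 7) ≠
      splitDiscriminantClass 3 7 := by
  have e : Units.mk0 (((-19889 : ℚ) / 713440)) (by norm_num) = -(Units.mk0 ((19889 : ℚ) / 713440) (by norm_num)) := Units.ext (by norm_num)
  rw [Ne, e, mk_neg_eq_splitDiscriminantClass_iff_of_odd (n := 3) (by decide)]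
  have h := mul_not_mem_normUnitsSubgroup (mem_normUnitsSubgroup_of_sq_add_mul_sq (d := 7) (a := ((19889 : ℚ) / 46373600)) (by norm_num) ((-83 : ℚ) / 7280) ((-333 : ℚ) / 50960) (by norm_num))
    Summit.HodgeConjecture.HodgeConjecture.Ring2.WeilCoverage.SqrtNeg7.not_mem_65
  rw [mk0_mul_mk0] at h
  norm_num at h
  exact h

/-- The same datum, CELL IDENTIFICATION: `[det H|_B] = [-65]` in `ℚˣ/Nm(ℚ(√-7)ˣ)` — the census ROW KEY of `W6.7.65` (`a·65 = ((19889 : ℚ) / 10976) = (((-83 : ℚ) / 112))² + 7·(((-333 : ℚ) / 784))²`).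
research route conditional on HC_CM; not a corollary; Q11.4-sentence-2 already refuted in dim ≥ 3. [cite: vanGeemen1994HodgeAV, Lemma 5.2 (3)] -/
theorem fibre7_L27cS65_n65_072418_mk_detH_eq_key :
    (QuotientGroup.mk (Units.mk0 (-(((19889 : ℚ) / 713440))) (neg_ne_zero.2 (by norm_num))) : weilNormResidueGroup 7) =
      QuotientGroup.mk (Units.mk0 (-(65 : ℚ)) (neg_ne_zero.2 (by norm_num))) :=
  mk_neg_eq_mk_neg_of_mul_mem (by norm_num) (by norm_num)
    (mem_normUnitsSubgroup_of_sq_add_mul_sq _ ((-83 : ℚ) / 112) ((-333 : ℚ) / 784) (by norm_num))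

/-- FIBRE-PRODUCT datum `L27cxA85` `(0; 2:2^42.1,3:3^27.1^4,7a:7^12.1)` (cycle types in `A85`; Hurwitz dimension 0; CONSTRUCTED by depth-first search on planar hypermaps of the prescribed type (`planmap.py`; the random search fails on near-regular cycle types), then certified: generation: 2-transitive + Jordan (a random word of the branch cycles has a single 79-cycle, 79 prime, n/2 < 79 <= n-3): `Y = D ×_{ℙ¹} X` (genus 55; `D` the `L27c`-quotient datum = the `H₁`-quotient of the `L27c`-curve `C̃/A85`, `X` the degree-85 cover, genus 0), computed on its 4760 sheets (engine `bigwin.py` with the sparse cohomology `fastcover.py`, exact); the HIDDEN FACTOR `B` = the `λ`-part of the Prym `P(Y/D)` — an abelian SIXFOLD with `(3,3)` `ℚ(√-7)`-action, WEIL TYPE — has literal `det H|_B = -15667/1865920`, `a = 15667/1865920`, `T(a) = [5, 17]`: row `W6.7.85` (NON-split); `r₁ = dim_K H¹(D)_λ = 1`, `r_H = 7`. THEOREM S8 (Prym form of the product-window law, census b04.15 (A): `[a_B] = [n]^{r₁}`, no 2-transitivity needed) predicts `T(a_B) = [5, 17]` from `r₁ = 1`, `n = 85` — CONFIRMED.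
research route conditional on HC_CM; not a corollary; Q11.4-sentence-2 already refuted in dim ≥ 3. [cite: vanGeemen1994HodgeAV, (5.4.1)] -/
theorem fibre7_L27cA85_n85_b61f76_mk_detH_ne_split :
    (QuotientGroup.mk (Units.mk0 (((-15667 : ℚ) / 1865920)) (by norm_num)) : weilNormResidueGroup 7) ≠
      splitDiscriminantClass 3 7 := by
  have e : Units.mk0 (((-15667 : ℚ) / 1865920)) (by norm_num) = -(Units.mk0 ((15667 : ℚ) / 1865920) (by norm_num)) := Units.ext (by norm_num)
  rw [Ne, e, mk_neg_eq_splitDiscriminantClass_iff_of_odd (n := 3) (by decide)]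
  have h := mul_not_mem_normUnitsSubgroup (mem_normUnitsSubgroup_of_sq_add_mul_sq (d := 7) (a := ((15667 : ℚ) / 158603200)) (by norm_num) ((-37 : ℚ) / 4760) ((39 : ℚ) / 16660) (by norm_num))
    Summit.HodgeConjecture.HodgeConjecture.Ring2.WeilCoverage.SqrtNeg7.not_mem_85
  rw [mk0_mul_mk0] at h
  norm_num at h
  exact h

/-- The same datum, CELL IDENTIFICATION: `[det H|_B] = [-85]` in `ℚˣ/Nm(ℚ(√-7)ˣ)` — the census ROW KEY of `W6.7.85` (`a·85 = ((15667 : ℚ) / 21952) = (((-37 : ℚ) / 56))² + 7·(((39 : ℚ) / 196))²`).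
research route conditional on HC_CM; not a corollary; Q11.4-sentence-2 already refuted in dim ≥ 3. [cite: vanGeemen1994HodgeAV, Lemma 5.2 (3)] -/
theorem fibre7_L27cA85_n85_b61f76_mk_detH_eq_key :
    (QuotientGroup.mk (Units.mk0 (-(((15667 : ℚ) / 1865920))) (neg_ne_zero.2 (by norm_num))) : weilNormResidueGroup 7) =
      QuotientGroup.mk (Units.mk0 (-(85 : ℚ)) (neg_ne_zero.2 (by norm_num))) :=
  mk_neg_eq_mk_neg_of_mul_mem (by norm_num) (by norm_num)
    (mem_normUnitsSubgroup_of_sq_add_mul_sq _ ((-37 : ℚ) / 56) ((39 : ℚ) / 196) (by norm_num))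

/-! ### §4 ×2 of ring2-b06's `W6.7.15`: `PSL₂(7) × A₇`-on-15 -/

/-- FIBRE-PRODUCT datum `L27cxA7on15` `(0; 2:222222,4:4442,7a:77A)` (`A₇` acting on the 15 cosets of a subgroup `PSL₂(7)`; classes by cycle type: `2⁶.1³`, `4³.2.1`, `7².1`; Hurwitz dimension 0; realised by explicit permutations with product one, x2 of ring2-b06 W6.7.15 (their `A7on15` window, b06 g99)): `Y = D ×_{ℙ¹} X` (genus 46; `D` the `L27c`-quotient datum = the `H₁`-quotient of the `L27c`-curve `C̃/A7on15`, `X` the degree-15 cover, genus 0), computed on its 840 sheets (engine `bigwin.py` with the sparse cohomology `fastcover.py`, exact); the HIDDEN FACTOR `B` = the `λ`-part of the Prym `P(Y/D)` — an abelian SIXFOLD with `(3,3)` `ℚ(√-7)`-action, WEIL TYPE — has literal `det H|_B = -14023/2634240`, `a = 14023/2634240`, `T(a) = [3, 5]`: row `W6.7.15` (NON-split); `r₁ = dim_K H¹(D)_λ = 1`, `r_H = 7`. THEOREM S8 (Prym form of the product-window law, census b04.15 (A): `[a_B] = [n]^{r₁}`, no 2-transitivity needed) predicts `T(a_B) = [3,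 5]` from `r₁ = 1`, `n = 15` — CONFIRMED.
research route conditional on HC_CM; not a corollary; Q11.4-sentence-2 already refuted in dim ≥ 3. [cite: vanGeemen1994HodgeAV, (5.4.1)] -/
theorem fibre7_L27cA7on15_n15_3ed1b3_mk_detH_ne_split :
    (QuotientGroup.mk (Units.mk0 (((-14023 : ℚ) / 2634240)) (by norm_num)) : weilNormResidueGroup 7) ≠
      splitDiscriminantClass 3 7 := by
  have e : Units.mk0 (((-14023 : ℚ) / 2634240)) (by norm_num) = -(Units.mk0 ((14023 : ℚ) / 2634240) (by norm_num)) := Units.ext (by norm_num)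
  rw [Ne, e, mk_neg_eq_splitDiscriminantClass_iff_of_odd (n := 3) (by decide)]
  have h := mul_not_mem_normUnitsSubgroup (mem_normUnitsSubgroup_of_sq_add_mul_sq (d := 7) (a := ((14023 : ℚ) / 39513600)) (by norm_num) ((47 : ℚ) / 6720) ((-311 : ℚ) / 47040) (by norm_num))
    Summit.HodgeConjecture.HodgeConjecture.Ring2.WeilCoverage.SqrtNeg7.not_mem_15
  rw [mk0_mul_mk0] at h
  norm_num at h
  exact h

/-- The same datum, CELL IDENTIFICATION: `[det H|_B] = [-15]` in `ℚˣ/Nm(ℚ(√-7)ˣ)` — the census ROW KEY of `W6.7.15` (`a·15 = ((14023 : ℚ) / 175616) = (((47 : ℚ) / 448))² + 7·(((-311 : ℚ) / 3136))²`).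
research route conditional on HC_CM; not a corollary; Q11.4-sentence-2 already refuted in dim ≥ 3. [cite: vanGeemen1994HodgeAV, Lemma 5.2 (3)] -/
theorem fibre7_L27cA7on15_n15_3ed1b3_mk_detH_eq_key :
    (QuotientGroup.mk (Units.mk0 (-(((14023 : ℚ) / 2634240))) (neg_ne_zero.2 (by norm_num))) : weilNormResidueGroup 7) =
      QuotientGroup.mk (Units.mk0 (-(15 : ℚ)) (neg_ne_zero.2 (by norm_num))) :=
  mk_neg_eq_mk_neg_of_mul_mem (by norm_num) (by norm_num)
    (mem_normUnitsSubgroup_of_sq_add_mul_sq _ ((47 : ℚ) / 448) ((-311 : ℚ) / 3136) (by norm_num))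

end Summit.HodgeConjecture.HodgeConjecture.Ring2.WeilCoverage
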